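/-
Copyright: the b2b-balaban T⁴-continuum CRUX team, row NE7b leaf lineage `t4-ne7b-formalise-leaf-05` (gen 161). Project licence.
-/
import Summits.QuantumFields.BalabanUV.T4Continuum.Spine.NE7b.BlockAverageTowerLetters

/-!
# THE ℕ-INDEXED RECURSIVE GAUSSIAN TOWER ON PRINT's TORI — over ANY level family `N (j+1) = L·N j`, from the unit Dirichlet form of
# the finest level `k`, the `k` hard steps `V_j = L^{2−d}·(V_{j+1})⁺` (critical section of `Q′_L` at every level) EXIST, are UNIQUE,
# and obey AT EVERY LEVEL the SAME letters: (1.67) `R_j ≤ V_j ≤ γ₁(d)·R_j`, the next-kernel floor `2∕L²`, and «`V_0` is a one-shot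
# effective form» — BATL's re-entrant invariant run under `Nat.le_induction`, outputs existential with their recursion equations
# (SET's shape); the instance `N j = L^j·M` (row NE7b, node U5c; [folklore] over this lineage's BATL BY NAME)

Cell `pub-balaban`, sub-cell `t4`, spine estimate NE7b (`T4WeightBudget.RelWeightBound`; the cell's OWN estimate — NOT PRINTED in
[Bałaban 1983–89], NOT PROVED).  Crux-route work under `Spine/NE7b/` by a row leaf (`t4-ne7b-formalise-leaf-05` gen 161) under FREEZE (0)'s
crux-prover clause; the ninth file of this lineage's hard-flow packet, the packaging BATL (`…BlockAverageTowerLetters`) names under NOT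
HERE.  NOTHING of Bałaban's is asserted: typed (1.20) `B5Block118.QsOp`, (1.4)∕(1.21) `B5Action121.GradOp`, the relabelling
`B5Composition116.recast`, the Literature constant `B5Ineq167UpperZd.gamma1` BY NAME, and BATL's kernel theorems.  No `T4Continuum/Support`
leaf typed; no `def` (the tower's families are EXISTENTIAL outputs pinned by their recursion equations, as in leaf-06's
`…SupEquationTower.tower_eq`); zero `sorry`.

WHY (located).  BATL proved the invariant «the level form is a one-shot effective form» is born, preserved and letter-carrying; the
product-free `k`-uniformity it promises is only USABLE once somebody runs the induction with honest carrier bookkeeping: level `j+1` of a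
user's tower lives on `Tor (N (j+1))`, which is print's `Tor (fine L (N j))` only up to the canonical relabelling `recast` (the moduli
agree propositionally, `L·(N j) = N (j+1)`, not syntactically).  §2 transports BATL's three invariant lemmas across that relabelling
(`subst` + `recast_self_apply`), §3 runs `Nat.le_induction` over ALL level families at once (the inductive step SHIFTS the family,
`N ↦ N (·+1)`, and adds the new COARSEST step at the bottom — where BATL's `nextStep_of_oneShot` supplies the critical section and
`oneShot_step` re-reads the new bottom form as one shot), §4 instantiates print's family `N j = L^j·M`.

WHAT IS PROVED ([folklore]; every `d`, `L ≥ 1`, `k ≥ 1`; `E_j = EuclideanSpace ℝ (Tor (N j))`; inputs: the unit Dirichlet forms `R j`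
(coordinates `(re ∂₁)ᵀ(re ∂₁)` on `Tor (N j)`) and the block averages `D j : E_{j+1} → E_j` (coordinates `re Q′_L` on `Tor (fine L (N j))`
read through `recast (e j)`), all abstract CLMs):
* §1 `recast_self_apply`, `comp_recast_self` (the relabelling along `A = A` is the identity).
* §2 `start_next'`, `oneShot_start'`, `oneShot_step'`, `nextStep_of_oneShot'` — BATL's `kernelFloor`∕`exists_start_section`∕
  `start_section_unique`, `oneShot_start`, `oneShot_step`, `nextStep_of_oneShot` with the finer level relabelled (`e : fine L P = P′`).
* §3 **`exists_tower`**: for every level family `N` with `e j : fine L (N j) = N (j+1)`, every `k ≥ 1`: `∃ V H` with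
  (top) `V k = R k`; (rec) for `j < k`: `D j (H j g) = g`, `V (j+1) (H j g) κ = 0` on `ker D j`, `V j = (L²∕L^d) • (V (j+1)).bilinearComp (H j) (H j)`;
  (floor) for `j < k`: `D j g = 0 ⟹ (2∕L²)‖g‖² ≤ V (j+1) g g`; (uniq) for `j < k` the critical section is unique; (sym) for `j < k`:
  `V j` symmetric and `≥ 0`; **(167) for `j < k`:
  `R j g g ≤ V j g g ≤ gamma1 d · R j g g` — THE SAME TWO CONSTANTS AT EVERY LEVEL OF EVERY HEIGHT-`k` TOWER**; (read) `V 0` is a one-shot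
  effective form `Q⁺_{(s, N 0)}` for some side `s`.
* §4 `levels_pow_succ` (`fine L (L^j·M) = L^{j+1}·M`), **`exists_tower_pow`** — §3 on print's tori `Tor (L^j·M)`, `j = 0, …, k`; toy.

NOT HERE (honest): the side of the bottom reading is `L^k` (tracked only existentially); the interacting ∕ non-linear tower; the
VECTOR law (1.17); `U ≠ 1`; `ℓ²(ℤ^d)`; (A3) ∕ (A1c), NC-NE7b-α UNRULED; `γ₁(d)` by value (useless, PRICING F794 — the content is its
level-independence); the junction with leaf-06's SECS seminorm families (its `N^w_j` letters are for the equation-map tower, a different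
object).  BY-NAME EFFECT ON THE WALL: NONE (the free scalar tower is lettered uniformly in `k`; the wall is (R2)).  NE7b NOT PRINTED ∕ NOT
PROVED; spine PROVED 0∕9; rung (B)+1 on a FINITE torus — NOT infinite volume, NOT the mass gap, NOT Clay.  HONEST DEPENDENCY: continuum
YM on T⁴ ⇐ BetaPertH ∧ nine spine estimates (0∕9 proved); BetaPertH ⇐ (D1) ∧ (D4) ∧ CAP+tail; G-an2-4 gates asym, D1 and NE2∕3∕4.
-/

set_option autoImplicit false

namespace Summit.QuantumFields.BalabanUV.T4Continuum.NE7b.BlockAverageTower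

open Matrix WithLp Finset
open Literature.MathematicalPhysics.QuantumFieldTheory.Balaban1983to89
open B5Prop11Plancherel (Tor fine)
open B5Action121 (GradOp)
open B5Block118 (QsOp)
open B5RealFields (reM)
open B5Composition116 (recast recast_apply)
open B5Ineq167UpperZd (gamma1)
open Summit.QuantumFields.BalabanUV.T4Continuum.NE7b.BlockAverageKernelFloor (kernelFloor_CLM)
open Summit.QuantumFields.BalabanUV.T4Continuum.NE7b.BlockAverageTowerLetters
  (oneShot_start exists_start_section start_section_unique oneShot_step letters_of_oneShot nextStep_of_oneShot)

variable {d : ℕ} (L : ℕ) [NeZero L]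

/-! ## §1. Relabelling bookkeeping: `recast` along `A = A` is the identity -/

section Recast

/-- `recast h z = z` for `h : ∀ ν, A ν = A ν` (componentwise `ZMod.ringEquivCongr rfl`). [folklore] -/
theorem recast_self_apply {A : Fin d → ℕ} (h : ∀ ν, A ν = A ν) (z : Tor A) : recast h z = z := by
  funext ν
  simp [recast_apply]

/-- A field read through the trivial relabelling is the field. [folklore] -/
theorem comp_recast_self {A : Fin d → ℕ} (h : ∀ ν, A ν = A ν) (f : Tor A → ℝ) : (fun z => f (recast h z)) = f :=
  funext fun z => by rw [recast_self_apply]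

end Recast

/-! ## §2. BATL's invariant lemmas with the finer level relabelled: `P′` any name of `fine L P` (`e : fine L P = P′`) -/

section Primed

variable (P P' : Fin d → ℕ) [hP : ∀ μ, NeZero (P μ)] [hP' : ∀ μ, NeZero (P' μ)]

/-- **THE FIRST STEP's LETTERS, RELABELLED**: `R′` the unit Dirichlet form of `Tor P′`, `D = re Q′_L` read through `recast e` ⟹ the kernel
floor `D g = 0 ⟹ (2∕L²)‖g‖² ≤ R′ g g` (BAKF `kernelFloor_CLM`), a critical section of `D` for `R′` EXISTS (BATL `exists_start_section`) and
is UNIQUE (BATL `start_section_unique`). [folklore] -/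
theorem start_next' (e : fine L P = P')
    {R' : EuclideanSpace ℝ (Tor P') →L[ℝ] EuclideanSpace ℝ (Tor P') →L[ℝ] ℝ}
    {D : EuclideanSpace ℝ (Tor P') →L[ℝ] EuclideanSpace ℝ (Tor P)}
    (hR' : ∀ x y, R' x y = ofLp x ⬝ᵥ (((reM (GradOp P' 1))ᵀ * reM (GradOp P' 1)) *ᵥ ofLp y))
    (hD : ∀ x, ofLp (D x) = reM (QsOp L P) *ᵥ fun z => ofLp x (recast (congrFun e) z)) :
    (∀ g, D g = 0 → 2 / (L : ℝ) ^ 2 * ‖g‖ ^ 2 ≤ R' g g) ∧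
      (∃ H : EuclideanSpace ℝ (Tor P) →L[ℝ] EuclideanSpace ℝ (Tor P'),
        (∀ g, D (H g) = g) ∧ (∀ g κ, D κ = 0 → R' (H g) κ = 0)) ∧
      (∀ H H' : EuclideanSpace ℝ (Tor P) →L[ℝ] EuclideanSpace ℝ (Tor P'),
        (∀ g, D (H g) = g) → (∀ g κ, D κ = 0 → R' (H g) κ = 0) →
        (∀ g, D (H' g) = g) → (∀ g κ, D κ = 0 → R' (H' g) κ = 0) → H = H') := by
  subst e
  have hD' : ∀ x, ofLp (D x) = reM (QsOp L P) *ᵥ ofLp x := fun x => by rw [hD, comp_recast_self]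
  exact ⟨fun g hg => kernelFloor_CLM L P hR' hD' g hg, exists_start_section L P hR' hD',
    fun H H' hH hHo hH' hH'o => start_section_unique L P hR' hD' hH hHo hH' hH'o⟩

/-- **THE READING IS BORN, RELABELLED** (BATL `oneShot_start` through `recast e`; the side is reported existentially). [folklore] -/
theorem oneShot_start' (e : fine L P = P')
    {R' : EuclideanSpace ℝ (Tor P') →L[ℝ] EuclideanSpace ℝ (Tor P') →L[ℝ] ℝ}
    {D : EuclideanSpace ℝ (Tor P') →L[ℝ] EuclideanSpace ℝ (Tor P)}
    (hR' : ∀ x y, R' x y = ofLp x ⬝ᵥ (((reM (GradOp P' 1))ᵀ * reM (GradOp P' 1)) *ᵥ ofLp y))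
    (hD : ∀ x, ofLp (D x) = reM (QsOp L P) *ᵥ fun z => ofLp x (recast (congrFun e) z))
    {H : EuclideanSpace ℝ (Tor P) →L[ℝ] EuclideanSpace ℝ (Tor P')}
    (hH : ∀ g, D (H g) = g) (hHo : ∀ g κ, D κ = 0 → R' (H g) κ = 0)
    {V : EuclideanSpace ℝ (Tor P) →L[ℝ] EuclideanSpace ℝ (Tor P) →L[ℝ] ℝ}
    (hV : V = ((L : ℝ) ^ 2 / (L : ℝ) ^ d) • R'.bilinearComp H H) :
    ∃ (s : ℕ) (_ : NeZero s)
      (Qₒ : EuclideanSpace ℝ (Tor (fine s P)) →L[ℝ] EuclideanSpace ℝ (Tor (fine s P)) →L[ℝ] ℝ)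
      (Dₒ : EuclideanSpace ℝ (Tor (fine s P)) →L[ℝ] EuclideanSpace ℝ (Tor P))
      (G : EuclideanSpace ℝ (Tor P) →L[ℝ] EuclideanSpace ℝ (Tor (fine s P))),
      (∀ x y, Qₒ x y = ofLp x ⬝ᵥ
        (((1 / (s : ℝ) ^ d) • ((reM (GradOp (fine s P) (s : ℂ)))ᵀ * reM (GradOp (fine s P) (s : ℂ)))) *ᵥ ofLp y)) ∧
      (∀ x, ofLp (Dₒ x) = reM (QsOp s P) *ᵥ ofLp x) ∧
      (∀ g, Dₒ (G g) = g) ∧ (∀ g κ, Dₒ κ = 0 → Qₒ (G g) κ = 0) ∧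
      V = Qₒ.bilinearComp G G := by
  subst e
  have hD' : ∀ x, ofLp (D x) = reM (QsOp L P) *ᵥ ofLp x := fun x => by rw [hD, comp_recast_self]
  obtain ⟨Qₒ, Dₒ, G, h⟩ := oneShot_start L P hR' hD' hH hHo hV
  exact ⟨L, inferInstance, Qₒ, Dₒ, G, h⟩

variable (s : ℕ) [NeZero s]

/-- **THE READING IS PRESERVED, RELABELLED**: `V′` on `Tor P′` read at side `s` over `P′`, `D = re Q′_L` through `recast e`, `H` critical
for `(V′, D)` ⟹ `(L²∕L^d) • V′.bilinearComp H H` is read at side `L·s` over `P` (BATL `oneShot_step`). [folklore] -/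
theorem oneShot_step' (e : fine L P = P')
    {V' : EuclideanSpace ℝ (Tor P') →L[ℝ] EuclideanSpace ℝ (Tor P') →L[ℝ] ℝ}
    {Qₒ' : EuclideanSpace ℝ (Tor (fine s P')) →L[ℝ] EuclideanSpace ℝ (Tor (fine s P')) →L[ℝ] ℝ}
    {Dₒ' : EuclideanSpace ℝ (Tor (fine s P')) →L[ℝ] EuclideanSpace ℝ (Tor P')}
    {G' : EuclideanSpace ℝ (Tor P') →L[ℝ] EuclideanSpace ℝ (Tor (fine s P'))}
    (hQₒ' : ∀ x y, Qₒ' x y = ofLp x ⬝ᵥ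
      (((1 / (s : ℝ) ^ d) • ((reM (GradOp (fine s P') (s : ℂ)))ᵀ * reM (GradOp (fine s P') (s : ℂ)))) *ᵥ ofLp y))
    (hDₒ' : ∀ x, ofLp (Dₒ' x) = reM (QsOp s P') *ᵥ ofLp x)
    (hG' : ∀ g, Dₒ' (G' g) = g) (hG'o : ∀ g κ, Dₒ' κ = 0 → Qₒ' (G' g) κ = 0) (hV' : V' = Qₒ'.bilinearComp G' G')
    {D : EuclideanSpace ℝ (Tor P') →L[ℝ] EuclideanSpace ℝ (Tor P)}
    (hD : ∀ x, ofLp (D x) = reM (QsOp L P) *ᵥ fun z => ofLp x (recast (congrFun e) z))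
    {H : EuclideanSpace ℝ (Tor P) →L[ℝ] EuclideanSpace ℝ (Tor P')}
    (hH : ∀ g, D (H g) = g) (hHo : ∀ g κ, D κ = 0 → V' (H g) κ = 0)
    {V : EuclideanSpace ℝ (Tor P) →L[ℝ] EuclideanSpace ℝ (Tor P) →L[ℝ] ℝ}
    (hV : V = ((L : ℝ) ^ 2 / (L : ℝ) ^ d) • V'.bilinearComp H H) :
    ∃ (Qₒ : EuclideanSpace ℝ (Tor (fine (L * s) P)) →L[ℝ] EuclideanSpace ℝ (Tor (fine (L * s) P)) →L[ℝ] ℝ)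
      (Dₒ : EuclideanSpace ℝ (Tor (fine (L * s) P)) →L[ℝ] EuclideanSpace ℝ (Tor P))
      (G : EuclideanSpace ℝ (Tor P) →L[ℝ] EuclideanSpace ℝ (Tor (fine (L * s) P))),
      (∀ x y, Qₒ x y = ofLp x ⬝ᵥ (((1 / ((L * s : ℕ) : ℝ) ^ d) •
        ((reM (GradOp (fine (L * s) P) ((L * s : ℕ) : ℂ)))ᵀ * reM (GradOp (fine (L * s) P) ((L * s : ℕ) : ℂ)))) *ᵥ ofLp y)) ∧
      (∀ x, ofLp (Dₒ x) = reM (QsOp (L * s) P) *ᵥ ofLp x) ∧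
      (∀ g, Dₒ (G g) = g) ∧ (∀ g κ, Dₒ κ = 0 → Qₒ (G g) κ = 0) ∧
      V = Qₒ.bilinearComp G G := by
  subst e
  have hD' : ∀ x, ofLp (D x) = reM (QsOp L P) *ᵥ ofLp x := fun x => by rw [hD, comp_recast_self]
  exact oneShot_step L P s hQₒ' hDₒ' hG' hG'o hV' hD' hH hHo hV

/-- **THE RECURSION CONTINUES, RELABELLED**: `V` on `Tor P′` read at side `s` over `P′` (`P′` a name of `fine L P₀`), `R′` its unit
Dirichlet form, `D = re Q′_L : Tor P′ → Tor P₀` through `recast e` ⟹ floor `2∕L²` on `ker D`, a critical section of `D` for `V` EXISTS and is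
UNIQUE (BATL `nextStep_of_oneShot`). [folklore] -/
theorem nextStep_of_oneShot' (P₀ : Fin d → ℕ) [∀ μ, NeZero (P₀ μ)] (e : fine L P₀ = P')
    {V : EuclideanSpace ℝ (Tor P') →L[ℝ] EuclideanSpace ℝ (Tor P') →L[ℝ] ℝ}
    {Qₒ : EuclideanSpace ℝ (Tor (fine s P')) →L[ℝ] EuclideanSpace ℝ (Tor (fine s P')) →L[ℝ] ℝ}
    {Dₒ : EuclideanSpace ℝ (Tor (fine s P')) →L[ℝ] EuclideanSpace ℝ (Tor P')}
    {G : EuclideanSpace ℝ (Tor P') →L[ℝ] EuclideanSpace ℝ (Tor (fine s P'))}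
    (hQₒ : ∀ x y, Qₒ x y = ofLp x ⬝ᵥ
      (((1 / (s : ℝ) ^ d) • ((reM (GradOp (fine s P') (s : ℂ)))ᵀ * reM (GradOp (fine s P') (s : ℂ)))) *ᵥ ofLp y))
    (hDₒ : ∀ x, ofLp (Dₒ x) = reM (QsOp s P') *ᵥ ofLp x)
    (hG : ∀ g, Dₒ (G g) = g) (hV : V = Qₒ.bilinearComp G G)
    {R' : EuclideanSpace ℝ (Tor P') →L[ℝ] EuclideanSpace ℝ (Tor P') →L[ℝ] ℝ}
    (hR' : ∀ g h, R' g h = ofLp g ⬝ᵥ (((reM (GradOp P' 1))ᵀ * reM (GradOp P' 1)) *ᵥ ofLp h))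
    {D : EuclideanSpace ℝ (Tor P') →L[ℝ] EuclideanSpace ℝ (Tor P₀)}
    (hD : ∀ g, ofLp (D g) = reM (QsOp L P₀) *ᵥ fun z => ofLp g (recast (congrFun e) z)) :
    (∀ g, D g = 0 → 2 / (L : ℝ) ^ 2 * ‖g‖ ^ 2 ≤ V g g) ∧
      (∃ H : EuclideanSpace ℝ (Tor P₀) →L[ℝ] EuclideanSpace ℝ (Tor P'),
        (∀ g, D (H g) = g) ∧ (∀ g κ, D κ = 0 → V (H g) κ = 0)) ∧
      (∀ H H' : EuclideanSpace ℝ (Tor P₀) →L[ℝ] EuclideanSpace ℝ (Tor P'),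
        (∀ g, D (H g) = g) → (∀ g κ, D κ = 0 → V (H g) κ = 0) →
        (∀ g, D (H' g) = g) → (∀ g κ, D κ = 0 → V (H' g) κ = 0) → H = H') := by
  subst e
  have hD' : ∀ g, ofLp (D g) = reM (QsOp L P₀) *ᵥ ofLp g := fun g => by rw [hD, comp_recast_self]
  exact nextStep_of_oneShot L s P₀ hQₒ hDₒ hG hV hR' hD'

end Primed

/-! ## §3. THE TOWER over an arbitrary level family -/

section Tower

/-- **THE RECURSIVE GAUSSIAN TOWER EXISTS, IS UNIQUE, AND IS LETTERED UNIFORMLY IN THE LEVEL.**  For every level family `N : ℕ → (Fin d → ℕ)`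
with `e j : fine L (N j) = N (j+1)` (level `j+1` refines level `j` by `L`), the unit Dirichlet forms `R j` of `Tor (N j)` and the block
averages `D j = re Q′_L : Tor (N (j+1)) → Tor (N j)` (read through `recast (e j)`), and every `k ≥ 1`: THERE ARE level forms `V j` and
sections `H j` with `V k = R k` (the finest level carries its unit Dirichlet form), and for every `j < k`: `H j` is THE critical section of
`D j` for `V (j+1)` (exists, unique), `V j = (L²∕L^d) • (V (j+1)).bilinearComp (H j) (H j)` (print's hard step with the canonical
rescaling), the next-kernel floor `D j g = 0 ⟹ (2∕L²)‖g‖² ≤ V (j+1) g g`, and **(1.67) `R j g g ≤ V j g g ≤ gamma1 d · R j g g` with the SAME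
constants at every level** (no product over the levels); moreover the bottom form `V 0` IS a one-shot effective form `Q⁺_{(s, N 0)}`.
Proof: `Nat.le_induction` on `k` over all families — shift `N ↦ N (·+1)` and add the coarsest step with §2. [folklore] -/
theorem exists_tower (k : ℕ) (hk : 1 ≤ k) :
    ∀ (N : ℕ → Fin d → ℕ) [∀ j μ, NeZero (N j μ)] (e : ∀ j, fine L (N j) = N (j + 1))
      (R : ∀ j, EuclideanSpace ℝ (Tor (N j)) →L[ℝ] EuclideanSpace ℝ (Tor (N j)) →L[ℝ] ℝ)
      (D : ∀ j, EuclideanSpace ℝ (Tor (N (j + 1))) →L[ℝ] EuclideanSpace ℝ (Tor (N j))),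
      (∀ j g h, R j g h = ofLp g ⬝ᵥ (((reM (GradOp (N j) 1))ᵀ * reM (GradOp (N j) 1)) *ᵥ ofLp h)) →
      (∀ j x, ofLp (D j x) = reM (QsOp L (N j)) *ᵥ fun z => ofLp x (recast (congrFun (e j)) z)) →
      ∃ (V : ∀ j, EuclideanSpace ℝ (Tor (N j)) →L[ℝ] EuclideanSpace ℝ (Tor (N j)) →L[ℝ] ℝ)
        (H : ∀ j, EuclideanSpace ℝ (Tor (N j)) →L[ℝ] EuclideanSpace ℝ (Tor (N (j + 1)))),
        V k = R k ∧
        (∀ j, j < k → (∀ g, D j (H j g) = g) ∧ (∀ g κ, D j κ = 0 → V (j + 1) (H j g) κ = 0) ∧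
          V j = ((L : ℝ) ^ 2 / (L : ℝ) ^ d) • (V (j + 1)).bilinearComp (H j) (H j)) ∧
        (∀ j, j < k → ∀ g, D j g = 0 → 2 / (L : ℝ) ^ 2 * ‖g‖ ^ 2 ≤ V (j + 1) g g) ∧
        (∀ j, j < k → ∀ H' : EuclideanSpace ℝ (Tor (N j)) →L[ℝ] EuclideanSpace ℝ (Tor (N (j + 1))),
          (∀ g, D j (H' g) = g) → (∀ g κ, D j κ = 0 → V (j + 1) (H' g) κ = 0) → H' = H j) ∧
        (∀ j, j < k → (∀ g h, V j g h = V j h g) ∧ (∀ g, 0 ≤ V j g g)) ∧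
        (∀ j, j < k → ∀ g, R j g g ≤ V j g g ∧ V j g g ≤ gamma1 d * R j g g) ∧
        (∃ (s : ℕ) (_ : NeZero s)
          (Qₒ : EuclideanSpace ℝ (Tor (fine s (N 0))) →L[ℝ] EuclideanSpace ℝ (Tor (fine s (N 0))) →L[ℝ] ℝ)
          (Dₒ : EuclideanSpace ℝ (Tor (fine s (N 0))) →L[ℝ] EuclideanSpace ℝ (Tor (N 0)))
          (G : EuclideanSpace ℝ (Tor (N 0)) →L[ℝ] EuclideanSpace ℝ (Tor (fine s (N 0)))),
          (∀ x y, Qₒ x y = ofLp x ⬝ᵥ (((1 / (s : ℝ) ^ d) •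
            ((reM (GradOp (fine s (N 0)) (s : ℂ)))ᵀ * reM (GradOp (fine s (N 0)) (s : ℂ)))) *ᵥ ofLp y)) ∧
          (∀ x, ofLp (Dₒ x) = reM (QsOp s (N 0)) *ᵥ ofLp x) ∧
          (∀ g, Dₒ (G g) = g) ∧ (∀ g κ, Dₒ κ = 0 → Qₒ (G g) κ = 0) ∧
          V 0 = Qₒ.bilinearComp G G) := by
  induction k, hk using Nat.le_induction with
  | base =>
    intro N _ e R D hR hD
    obtain ⟨hfl, ⟨H₀, hH₀, hH₀o⟩, huniq⟩ := start_next' L (N 0) (N 1) (e 0) (hR 1) (hD 0)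
    obtain ⟨s, hs, Qₒ, Dₒ, G, hQₒ, hDₒ, hG, hGo, hV₀⟩ :=
      oneShot_start' L (N 0) (N 1) (e 0) (hR 1) (hD 0) hH₀ hH₀o rfl
    obtain ⟨hsy, hpo, hlo, hhi⟩ := letters_of_oneShot (N 0) s hQₒ hDₒ hG hGo hV₀ (hR 0)
    refine ⟨fun j => match j with
        | 0 => ((L : ℝ) ^ 2 / (L : ℝ) ^ d) • (R 1).bilinearComp H₀ H₀
        | j + 1 => R (j + 1),
      fun j => match j with
        | 0 => H₀
        | _ + 1 => 0,
      rfl, ?_, ?_, ?_, ?_, ?_, ⟨s, hs, Qₒ, Dₒ, G, hQₒ, hDₒ, hG, hGo, hV₀⟩⟩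
    · intro j hj
      obtain rfl : j = 0 := by omega
      exact ⟨hH₀, hH₀o, rfl⟩
    · intro j hj
      obtain rfl : j = 0 := by omega
      exact hfl
    · intro j hj
      obtain rfl : j = 0 := by omega
      exact fun H' h₁ h₂ => huniq H' H₀ h₁ h₂ hH₀ hH₀o
    · intro j hj
      obtain rfl : j = 0 := by omega
      exact ⟨hsy, hpo⟩
    · intro j hj
      obtain rfl : j = 0 := by omega
      exact fun g => ⟨hlo g, hhi g⟩
  | succ k hk ih =>
    intro N _ e R D hR hD
    obtain ⟨V', H', htop, hrec, hfloor, huniq, hsp, h167, s, hs, Qₒ', Dₒ', G', hQₒ', hDₒ', hG', hG'o, hV'₀⟩ :=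
      ih (fun j => N (j + 1)) (fun j => e (j + 1)) (fun j => R (j + 1)) (fun j => D (j + 1))
        (fun j => hR (j + 1)) (fun j => hD (j + 1))
    obtain ⟨hfl, ⟨H₀, hH₀, hH₀o⟩, huniq₀⟩ :=
      nextStep_of_oneShot' L (N 1) s (N 0) (e 0) hQₒ' hDₒ' hG' hV'₀ (hR 1) (hD 0)
    obtain ⟨Qₒ, Dₒ, G, hQₒ, hDₒ, hG, hGo, hV₀⟩ :=
      oneShot_step' L (N 0) (N 1) s (e 0) hQₒ' hDₒ' hG' hG'o hV'₀ (hD 0) hH₀ hH₀o rfl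
    obtain ⟨hsy, hpo, hlo, hhi⟩ := letters_of_oneShot (N 0) (L * s) hQₒ hDₒ hG hGo hV₀ (hR 0)
    refine ⟨fun j => match j with
        | 0 => ((L : ℝ) ^ 2 / (L : ℝ) ^ d) • (V' 0).bilinearComp H₀ H₀
        | j + 1 => V' j,
      fun j => match j with
        | 0 => H₀
        | j + 1 => H' j,
      htop, ?_, ?_, ?_, ?_, ?_, ⟨L * s, inferInstance, Qₒ, Dₒ, G, hQₒ, hDₒ, hG, hGo, hV₀⟩⟩
    · intro j hj
      cases j with
      | zero => exact ⟨hH₀, hH₀o, rfl⟩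
      | succ j => exact hrec j (by omega)
    · intro j hj
      cases j with
      | zero => exact hfl
      | succ j => exact hfloor j (by omega)
    · intro j hj
      cases j with
      | zero => exact fun H'' h₁ h₂ => huniq₀ H'' H₀ h₁ h₂ hH₀ hH₀o
      | succ j => exact huniq j (by omega)
    · intro j hj
      cases j with
      | zero => exact ⟨hsy, hpo⟩
      | succ j => exact hsp j (by omega)
    · intro j hj
      cases j with
      | zero => exact fun g => ⟨hlo g, hhi g⟩
      | succ j => exact h167 j (by omega)

end Tower

/-! ## §4. Print's tori `Tor (L^j·M)` -/

section Pow

variable (M : Fin d → ℕ) [hM : ∀ μ, NeZero (M μ)]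

omit [NeZero L] hM in
/-- `fine L (L^j·M) = L^{j+1}·M`: print's level family refines by `L` at every level. [folklore] -/
theorem levels_pow_succ (j : ℕ) : fine L (fun μ => L ^ j * M μ) = fun μ => L ^ (j + 1) * M μ := by
  funext μ
  show L * (L ^ j * M μ) = L ^ (j + 1) * M μ
  ring

/-- **THE RECURSIVE GAUSSIAN TOWER ON PRINT's TORI `T^{(j)} = Tor (L^j·M)`, `j = 0, …, k`**: §3 for the family `N j = L^j·M` — from the unit
Dirichlet form of `Tor (L^k·M)`, `k` hard steps of side `L` with the rescaling `L^{2−d}`, each along THE critical section of `Q′_L`; at every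
level (1.67) holds with `(1, gamma1 d)` and the next-kernel floor is `2∕L²` — uniformly in `j`, `k`, `M`. [folklore] -/
theorem exists_tower_pow (k : ℕ) (hk : 1 ≤ k)
    (R : ∀ j, EuclideanSpace ℝ (Tor (fun μ => L ^ j * M μ)) →L[ℝ] EuclideanSpace ℝ (Tor (fun μ => L ^ j * M μ)) →L[ℝ] ℝ)
    (D : ∀ j, EuclideanSpace ℝ (Tor (fun μ => L ^ (j + 1) * M μ)) →L[ℝ] EuclideanSpace ℝ (Tor (fun μ => L ^ j * M μ)))
    (hR : ∀ j g h, R j g h = ofLp g ⬝ᵥ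
      (((reM (GradOp (fun μ => L ^ j * M μ) 1))ᵀ * reM (GradOp (fun μ => L ^ j * M μ) 1)) *ᵥ ofLp h))
    (hD : ∀ j x, ofLp (D j x) = reM (QsOp L (fun μ => L ^ j * M μ)) *ᵥ
      fun z => ofLp x (recast (congrFun (levels_pow_succ L M j)) z)) :
    ∃ (V : ∀ j, EuclideanSpace ℝ (Tor (fun μ => L ^ j * M μ)) →L[ℝ] EuclideanSpace ℝ (Tor (fun μ => L ^ j * M μ)) →L[ℝ] ℝ)
      (H : ∀ j, EuclideanSpace ℝ (Tor (fun μ => L ^ j * M μ)) →L[ℝ] EuclideanSpace ℝ (Tor (fun μ => L ^ (j + 1) * M μ))),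
      V k = R k ∧
      (∀ j, j < k → (∀ g, D j (H j g) = g) ∧ (∀ g κ, D j κ = 0 → V (j + 1) (H j g) κ = 0) ∧
        V j = ((L : ℝ) ^ 2 / (L : ℝ) ^ d) • (V (j + 1)).bilinearComp (H j) (H j)) ∧
      (∀ j, j < k → ∀ g, D j g = 0 → 2 / (L : ℝ) ^ 2 * ‖g‖ ^ 2 ≤ V (j + 1) g g) ∧
      (∀ j, j < k → ∀ H' : EuclideanSpace ℝ (Tor (fun μ => L ^ j * M μ)) →L[ℝ]
          EuclideanSpace ℝ (Tor (fun μ => L ^ (j + 1) * M μ)),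
        (∀ g, D j (H' g) = g) → (∀ g κ, D j κ = 0 → V (j + 1) (H' g) κ = 0) → H' = H j) ∧
      (∀ j, j < k → (∀ g h, V j g h = V j h g) ∧ (∀ g, 0 ≤ V j g g)) ∧
      (∀ j, j < k → ∀ g, R j g g ≤ V j g g ∧ V j g g ≤ gamma1 d * R j g g) := by
  obtain ⟨V, H, htop, hrec, hfloor, huniq, hsp, h167, -⟩ :=
    exists_tower L k hk (fun j μ => L ^ j * M μ) (levels_pow_succ L M) R D hR hD
  exact ⟨V, H, htop, hrec, hfloor, huniq, hsp, h167⟩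

/-- Toy: the letters do not see the height — a height-`k` tower on `Tor (2^j·M)` in `d = 4` has ceiling `gamma1 4 = 214 990 850` and floor
`2∕2² = 1∕2` at EVERY level, where the product bookkeeping would display `gamma1 4 ^ k` (`> 10^{16}` already at `k = 2`). -/
example : (2 : ℝ) / (2 : ℕ) ^ 2 = 1 / 2 ∧ ((2 : ℝ) + 8 * 4 ^ 2 * 36 ^ 4) ^ 2 > 1e16 := by norm_num

end Pow

end Summit.QuantumFields.BalabanUV.T4Continuum.NE7b.BlockAverageTower
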